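import Literature.Geometry.Lorentzian.ObstructionFreeGluing
import Mathlib.Analysis.Calculus.ContDiff.Bounds
import Mathlib.Analysis.InnerProductSpace.LinearMap

/-!
# `ParametricKerrBurial`, line `receding-annulus-universal-collar` — stub `stub_bulkFourthPower` (BK3d):
# `C²` Leibniz bound for the perturbed conformal metric `(u + e)⁴ δ − u⁴ δ` at a point of the gluing annulus

The registered stub `stub_bulkFourthPower` of crux `stmt-FinalStateConjecture-10052`
(`Summit.FinalStateConjecture.FinalStateConjecture.Theses.SwallowTheDatum.ParametricKerrBurial`), proved.
At every gluing site of the Brill–Lindquist bulk the OUT metric field is `(u + e)⁴ • δ`, `u` the exact isotropic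
Schwarzschild profile (all derivatives of order `≤ 2` of norm `≤ 2` at the point) and `e` a harmonic error of `C²`-size
`≤ ε ≤ 1` at the point; the field is then `C ε`-close in `C²` at the point to the model `u⁴ • δ`, `C = 4160`.

Proof. `(u + e)⁴ − u⁴ = ((u + e) + u) · ((u + e)(u + e) + u u) · e`; every factor is `C²` on the open set
`U = {16 < ‖y‖}`, so the Leibniz bound `norm_iteratedFDerivWithin_mul_le` on `U` (where `iteratedFDerivWithin = iteratedFDeriv`,
`iteratedFDerivWithin_of_isOpen`) and `∑ⱼ (i choose j) = 2ⁱ ≤ 4` bound the point derivatives of a product by `4 a b` from the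
bounds `a`, `b` of the factors (§1); sums add the bounds (`iteratedFDeriv_add_apply`); finally `D^i (f • δ) = (· • δ) ∘ D^i f`
(`iteratedFDeriv_smul_const_apply`) and `‖δ‖ = ‖innerSL ℝ‖ ≤ 1` (`norm_innerSL_le`). Bookkeeping:
`u + e ↦ 3`, `(u + e) + u ↦ 5`, `(u + e)(u + e) ↦ 36`, `u u ↦ 16`, their sum `↦ 52`, the product `↦ 4·5·52 = 1040`,
times `e ↦ 4·1040·ε = 4160 ε`.

* §1 `BulkFourthPower.norm_iteratedFDeriv_add_le / _mul_le / _smul_const_le` — point Leibniz bounds on an open set;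
* §2 `stub_bulkFourthPower` — the registered stub.

References: Mao–Oh–Tao arXiv:2308.13031 §1.2 (the `C²` deviation entering Thm 1.7); Brill–Lindquist, Phys. Rev. 131 (1963)
471, §II; the crux directory's `PICKED.md`. Mathlib only.
-/

set_option linter.dupNamespace false
-- the operator norm on `E3 [×m]→L[ℝ] (E3 →L[ℝ] E3 →L[ℝ] ℝ)` needs a longer instance search than the default budget
set_option synthInstance.maxHeartbeats 120000

noncomputable section

-- instance search through the nested operator types `E3 →L E3 →L ℝ`
set_option maxSynthPendingDepth 3

namespace Summit.FinalStateConjecture.FinalStateConjecture.Theorems.SwallowTheDatum.ParametricKerrBurial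

open scoped Manifold ContDiff Topology BigOperators InnerProductSpace
open Bundle Set Filter Function MeasureTheory Literature.Geometry.Lorentzian
open Literature.Geometry.Lorentzian.MaoOhTao Literature.Geometry.Lorentzian.InitialDataSet

namespace BulkFourthPower

/-! ## §1 Point Leibniz bounds for `C²` functions on an open set -/

/-- **Sum bound at a point.** On an open set `s`, for `f`, `g` of class `C²` on `s` with `‖D^j f(y)‖ ≤ a`,
`‖D^j g(y)‖ ≤ b` (`j ≤ 2`) at a point `y ∈ s`: `‖D^j (f + g)(y)‖ ≤ a + b` (`iteratedFDeriv_add_apply`). [folklore] -/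
theorem norm_iteratedFDeriv_add_le {s : Set E3} (hs : IsOpen s) {f g : E3 → ℝ}
    (hf : ContDiffOn ℝ 2 f s) (hg : ContDiffOn ℝ 2 g s) {y : E3} (hy : y ∈ s) {a b : ℝ}
    (ha : ∀ j ≤ 2, ‖iteratedFDeriv ℝ j f y‖ ≤ a) (hb : ∀ j ≤ 2, ‖iteratedFDeriv ℝ j g y‖ ≤ b) :
    ∀ j ≤ 2, ‖iteratedFDeriv ℝ j (fun z ↦ f z + g z) y‖ ≤ a + b := by
  intro j hj
  have hj' : ((j : ℕ) : ℕ∞ω) ≤ 2 := by exact_mod_cast hj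
  have hfa : ContDiffAt ℝ j f y := (hf.of_le hj').contDiffAt (hs.mem_nhds hy)
  have hga : ContDiffAt ℝ j g y := (hg.of_le hj').contDiffAt (hs.mem_nhds hy)
  have e₁ : (fun z ↦ f z + g z) = f + g := rfl
  rw [e₁, iteratedFDeriv_add_apply hfa hga]
  exact (norm_add_le _ _).trans (add_le_add (ha j hj) (hb j hj))

/-- **Leibniz bound at a point.** On an open set `s`, for `φ`, `ψ` of class `C²` on `s` with `‖D^j φ(y)‖ ≤ C`,
`‖D^j ψ(y)‖ ≤ ε` (`j ≤ 2`) at a point `y ∈ s`: `‖D^i (φ ψ)(y)‖ ≤ 4 C ε` for `i ≤ 2`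
(`norm_iteratedFDerivWithin_mul_le` on `s`, `iteratedFDerivWithin_of_isOpen`, `∑ⱼ (i choose j) = 2ⁱ ≤ 4`). [folklore] -/
theorem norm_iteratedFDeriv_mul_le {s : Set E3} (hs : IsOpen s) {φ ψ : E3 → ℝ}
    (hφ : ContDiffOn ℝ 2 φ s) (hψ : ContDiffOn ℝ 2 ψ s) {y : E3} (hy : y ∈ s) {C ε : ℝ}
    (hC : ∀ j ≤ 2, ‖iteratedFDeriv ℝ j φ y‖ ≤ C) (hε : ∀ j ≤ 2, ‖iteratedFDeriv ℝ j ψ y‖ ≤ ε) :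
    ∀ i ≤ 2, ‖iteratedFDeriv ℝ i (fun z ↦ φ z * ψ z) y‖ ≤ 4 * C * ε := by
  intro i hi
  have hsu : UniqueDiffOn ℝ s := hs.uniqueDiffOn
  have hC0 : 0 ≤ C := (norm_nonneg _).trans (hC 0 (Nat.zero_le _))
  have hε0 : 0 ≤ ε := (norm_nonneg _).trans (hε 0 (Nat.zero_le _))
  rw [← iteratedFDerivWithin_of_isOpen i hs hy]
  have hin : (i : ℕ∞ω) ≤ 2 := by exact_mod_cast hi
  refine (norm_iteratedFDerivWithin_mul_le hφ hψ hsu hy hin).trans ?_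
  have hterm : ∀ j ∈ Finset.range (i + 1),
      (i.choose j : ℝ) * ‖iteratedFDerivWithin ℝ j φ s y‖ * ‖iteratedFDerivWithin ℝ (i - j) ψ s y‖ ≤
        (i.choose j : ℝ) * C * ε := fun j hj ↦ by
    have hj : j ≤ i := Nat.lt_succ_iff.mp (Finset.mem_range.mp hj)
    rw [iteratedFDerivWithin_of_isOpen j hs hy, iteratedFDerivWithin_of_isOpen (i - j) hs hy]
    have h1 := hC j (hj.trans hi)
    have h2 := hε (i - j) ((Nat.sub_le i j).trans hi)
    have hc : (0 : ℝ) ≤ i.choose j := Nat.cast_nonneg _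
    exact mul_le_mul (mul_le_mul_of_nonneg_left h1 hc) h2 (norm_nonneg _) (mul_nonneg hc hC0)
  refine (Finset.sum_le_sum hterm).trans ?_
  rw [← Finset.sum_mul, ← Finset.sum_mul]
  have h := Nat.sum_range_choose i
  have h2 : (∑ j ∈ Finset.range (i + 1), (i.choose j : ℝ)) = 2 ^ i := by exact_mod_cast h
  rw [h2]
  have h4 : (2 : ℝ) ^ i ≤ 4 :=
    calc (2 : ℝ) ^ i ≤ 2 ^ 2 := pow_le_pow_right₀ one_le_two hi
    _ = 4 := by norm_num
  exact mul_le_mul_of_nonneg_right (mul_le_mul_of_nonneg_right h4 hC0) hε0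

/-- **Constant-vector bound at a point.** On an open set `s`, for `f` of class `C²` on `s` and a constant vector `L`:
`‖D^i (f • L)(y)‖ ≤ ‖L‖ ‖D^i f(y)‖` for `i ≤ 2`, `y ∈ s` (`iteratedFDeriv_smul_const_apply`). [folklore] -/
theorem norm_iteratedFDeriv_smul_const_le {s : Set E3} (hs : IsOpen s) {f : E3 → ℝ}
    (hf : ContDiffOn ℝ 2 f s) {y : E3} (hy : y ∈ s) (L : E3 →L[ℝ] E3 →L[ℝ] ℝ) {i : ℕ} (hi : i ≤ 2) :
    ‖iteratedFDeriv ℝ i (fun z ↦ f z • L) y‖ ≤ ‖L‖ * ‖iteratedFDeriv ℝ i f y‖ := by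
  have hi' : ((i : ℕ) : ℕ∞ω) ≤ 2 := by exact_mod_cast hi
  have hfa : ContDiffAt ℝ i f y := (hf.of_le hi').contDiffAt (hs.mem_nhds hy)
  rw [iteratedFDeriv_smul_const_apply hfa]
  refine (ContinuousLinearMap.norm_compContinuousMultilinearMap_le _ _).trans ?_
  rw [ContinuousLinearMap.norm_smulRight_apply, ContinuousLinearMap.norm_id, one_mul]

/-- The algebra of the stub: `(a + b)⁴ − a⁴ = ((a + b) + a) · ((a + b)(a + b) + a a) · b`. [folklore] -/
theorem fourth_power_sub (a b : ℝ) : (a + b) ^ 4 - a ^ 4 = ((a + b) + a) * ((a + b) * (a + b) + a * a) * b := by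
  ring

end BulkFourthPower

/-! ## §2 The registered stub -/

/-- **Stub `stub_bulkFourthPower` (BK3d).** There is an absolute constant `C > 0` (`C = 4160`) such that for real
functions `u`, `e` of class `C²` on `{16 < ‖y‖} ⊆ ℝ³`, a point `x` with `16 < ‖x‖`, `‖D^m u(x)‖ ≤ 2` and
`‖D^m e(x)‖ ≤ ε ≤ 1` for `m ≤ 2`, the perturbed conformal metric satisfies
`‖D^m ((u + e)⁴ δ − u⁴ δ)(x)‖ ≤ C ε` for `m ≤ 2` (`δ = innerSL ℝ`; Leibniz at the point). [folklore] -/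
theorem stub_bulkFourthPower : ∃ C : ℝ, 0 < C ∧ ∀ (u e : E3 → ℝ) (x : E3) (ε : ℝ), 16 < ‖x‖ →
    ContDiffOn ℝ 2 u {y : E3 | 16 < ‖y‖} → ContDiffOn ℝ 2 e {y : E3 | 16 < ‖y‖} →
    (∀ m : ℕ, m ≤ 2 → ‖iteratedFDeriv ℝ m u x‖ ≤ 2) → 0 ≤ ε → ε ≤ 1 →
    (∀ m : ℕ, m ≤ 2 → ‖iteratedFDeriv ℝ m e x‖ ≤ ε) →
    ∀ m : ℕ, m ≤ 2 →
      ‖iteratedFDeriv ℝ m (fun y : E3 ↦ ((u y + e y) ^ 4 - u y ^ 4) • (innerSL ℝ : E3 →L[ℝ] E3 →L[ℝ] ℝ)) x‖ ≤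
        C * ε := by
  refine ⟨4160, by norm_num, ?_⟩
  intro u e x ε hx hu he hub _hε0 hε1 heb m hm
  have hU : IsOpen {y : E3 | 16 < ‖y‖} := isOpen_lt continuous_const continuous_norm
  have hxU : x ∈ {y : E3 | 16 < ‖y‖} := hx
  -- `v = u + e ↦ 3`
  have hv : ContDiffOn ℝ 2 (fun y ↦ u y + e y) {y : E3 | 16 < ‖y‖} := hu.add he
  have hvb : ∀ j ≤ 2, ‖iteratedFDeriv ℝ j (fun y ↦ u y + e y) x‖ ≤ 3 := fun j hj ↦
    (BulkFourthPower.norm_iteratedFDeriv_add_le hU hu he hxU hub heb j hj).trans (by linarith)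
  -- `w = (u + e) + u ↦ 5`
  have hw : ContDiffOn ℝ 2 (fun y ↦ (u y + e y) + u y) {y : E3 | 16 < ‖y‖} := hv.add hu
  have hwb : ∀ j ≤ 2, ‖iteratedFDeriv ℝ j (fun y ↦ (u y + e y) + u y) x‖ ≤ 5 := fun j hj ↦
    (BulkFourthPower.norm_iteratedFDeriv_add_le hU hv hu hxU hvb hub j hj).trans (by norm_num)
  -- `(u + e)(u + e) ↦ 36`, `u u ↦ 16`, their sum `q ↦ 52`
  have hv2 : ContDiffOn ℝ 2 (fun y ↦ (u y + e y) * (u y + e y)) {y : E3 | 16 < ‖y‖} := hv.mul hv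
  have hv2b : ∀ j ≤ 2, ‖iteratedFDeriv ℝ j (fun y ↦ (u y + e y) * (u y + e y)) x‖ ≤ 36 := fun j hj ↦
    (BulkFourthPower.norm_iteratedFDeriv_mul_le hU hv hv hxU hvb hvb j hj).trans (by norm_num)
  have hu2 : ContDiffOn ℝ 2 (fun y ↦ u y * u y) {y : E3 | 16 < ‖y‖} := hu.mul hu
  have hu2b : ∀ j ≤ 2, ‖iteratedFDeriv ℝ j (fun y ↦ u y * u y) x‖ ≤ 16 := fun j hj ↦
    (BulkFourthPower.norm_iteratedFDeriv_mul_le hU hu hu hxU hub hub j hj).trans (by norm_num)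
  have hq : ContDiffOn ℝ 2 (fun y ↦ (u y + e y) * (u y + e y) + u y * u y) {y : E3 | 16 < ‖y‖} := hv2.add hu2
  have hqb : ∀ j ≤ 2, ‖iteratedFDeriv ℝ j (fun y ↦ (u y + e y) * (u y + e y) + u y * u y) x‖ ≤ 52 :=
    fun j hj ↦ (BulkFourthPower.norm_iteratedFDeriv_add_le hU hv2 hu2 hxU hv2b hu2b j hj).trans (by norm_num)
  -- `P = w q ↦ 1040`, `P e ↦ 4160 ε`
  have hP : ContDiffOn ℝ 2 (fun y ↦ ((u y + e y) + u y) * ((u y + e y) * (u y + e y) + u y * u y))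
      {y : E3 | 16 < ‖y‖} := hw.mul hq
  have hPb : ∀ j ≤ 2,
      ‖iteratedFDeriv ℝ j (fun y ↦ ((u y + e y) + u y) * ((u y + e y) * (u y + e y) + u y * u y)) x‖ ≤ 1040 :=
    fun j hj ↦ (BulkFourthPower.norm_iteratedFDeriv_mul_le hU hw hq hxU hwb hqb j hj).trans (by norm_num)
  have hPe : ContDiffOn ℝ 2 (fun y ↦ ((u y + e y) + u y) * ((u y + e y) * (u y + e y) + u y * u y) * e y)
      {y : E3 | 16 < ‖y‖} := hP.mul he
  have hPeb : ∀ j ≤ 2,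
      ‖iteratedFDeriv ℝ j (fun y ↦ ((u y + e y) + u y) * ((u y + e y) * (u y + e y) + u y * u y) * e y) x‖ ≤
        4 * 1040 * ε :=
    BulkFourthPower.norm_iteratedFDeriv_mul_le hU hP he hxU hPb heb
  -- the field is `(P e) • δ`
  have hfun : (fun y : E3 ↦ ((u y + e y) ^ 4 - u y ^ 4) • (innerSL ℝ : E3 →L[ℝ] E3 →L[ℝ] ℝ)) =
      fun y ↦ (((u y + e y) + u y) * ((u y + e y) * (u y + e y) + u y * u y) * e y) •
        (innerSL ℝ : E3 →L[ℝ] E3 →L[ℝ] ℝ) := by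
    funext y
    rw [BulkFourthPower.fourth_power_sub]
  rw [hfun]
  have hL : ‖(innerSL ℝ : E3 →L[ℝ] E3 →L[ℝ] ℝ)‖ ≤ 1 := norm_innerSL_le ℝ
  calc ‖iteratedFDeriv ℝ m (fun y ↦ (((u y + e y) + u y) * ((u y + e y) * (u y + e y) + u y * u y) * e y) •
          (innerSL ℝ : E3 →L[ℝ] E3 →L[ℝ] ℝ)) x‖
      ≤ ‖(innerSL ℝ : E3 →L[ℝ] E3 →L[ℝ] ℝ)‖ *
          ‖iteratedFDeriv ℝ m (fun y ↦ ((u y + e y) + u y) * ((u y + e y) * (u y + e y) + u y * u y) * e y) x‖ :=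
        BulkFourthPower.norm_iteratedFDeriv_smul_const_le hU hPe hxU _ hm
    _ ≤ 1 * (4 * 1040 * ε) := mul_le_mul hL (hPeb m hm) (norm_nonneg _) zero_le_one
    _ = 4160 * ε := by ring

end Summit.FinalStateConjecture.FinalStateConjecture.Theorems.SwallowTheDatum.ParametricKerrBurial
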